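import Literature.MathematicalPhysics.QuantumFieldTheory.Balaban1983to89.B15Ineq191Lattice
import Literature.MathematicalPhysics.QuantumFieldTheory.Balaban1983to89.B15HDecayLeaves
import Literature.MathematicalPhysics.QuantumFieldTheory.Balaban1983to89.B15GammaSmallness

/-!
# `Balaban1983to89.B15Ineq191From190` — [Balaban1989LargeFieldI] (1.90)–(1.91) p. 198: *"The function ℍ_{h,□} and it[s]
# derivatives can be bounded on □^∼ by B₃exp(−δ2LM₂R_h)11d²ε_h < 11d²B₃exp(−R_h)ε_h < αε_h … Estimating as in (1.46) we
# get [(1.91)]"* — ON THE LATTICE MODEL, END-TO-END FROM [15] (190): r12's `B15HDecayLeaves.boundH190_of_ineq190` (the first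
# member from (190)), `B15GammaSmallness.boundH190_lt_alpha_of_gamma` (members 2–3 from γ), the dictionary, and r12's
# `B15Ineq191Lattice.ineq191_lattice(_twoSup)` ((1.91) from the ℍ-bounds by p29's plaquette mechanism)

statement-level skeleton of published theorems with citation tags; proofs where landed; nothing here is a claim about
the Yang–Mills mass gap.

CITATION HEADER (lean-in-tree rule 2026-08-18).  T. Bałaban, *Large field renormalization. I. The basic step of the 𝐑
operation*, Commun. Math. Phys. **122**, 175–202 (1989), doi:10.1007/BF01257412, bib `Balaban1989LargeFieldI` (cell paper
B15; PDF held `paper:balaban1989-cmp122-large-field-i`; p. 198 = PDF 24, OCR `p0024.txt` + x2 render).  "[15]" =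
[Balaban1985Variational] (190) p. 308; "[3]" = [Balaban1984PropagatorsII] (2.61); "[14]" = [Balaban1985LGTPropagators]
(1.43)–(1.46); "[III]" = [Balaban1988Convergent] (2.5).  WHAT IS REPRODUCED: SKELETON rows `B15.Eq1.90` (the ℍ_{h,□}-chain)
and `B15.Eq1.91`, unit `lit-balaban-r12` gen 8, HOME `run/shared/lean/pub/lit-balaban/` (`lit-balaban-r12/ROWS-B15.md`; GAPS
G-B15-05).  KNITTING — used BY NAME, nothing restated: `B15HDecayLeaves.boundH190_of_ineq190`,
`B15GammaSmallness.boundH190_lt_alpha_of_gamma`, `B15Ineq191Lattice.ineq191_lattice`, `B15Ineq191Lattice.ineq191_lattice_twoSup`.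

THE PRINTED TEXT (p. 198 [PDF 24], verbatim, re-read on the page image): *"The function ℍ_{h,□} and it[s] derivatives can be
bounded on □^∼ by B₃exp(−δ2LM₂R_h)11d²ε_h < 11d²B₃exp(−R_h)ε_h < αε_h, where α is a small, absolute constant, which will be
fixed later. Estimating as in (1.46) we get |U″_{k,Z}(∂p) − 1| < |U_{h,□}(V″, ∂p) − 1|(1 + L^{−h}αε_h) + (α + 8α²ε_h)ε_h(L^{k−h}η)²
for p ⊂ □^∼. (1.91)"*; p. 199 [PDF 25]: *"We have chosen α = 1/12 in (1.91), (1.94), (1.95)."*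
v1.3 (r12 gen 19, 2026-08-22; `lit-balaban-r12/QUOTE-AUDIT-B15.md` finding A4): DOCSTRING ONLY — the p. 198 quotation above
restored verbatim (v1–v1.2 carried inside the quotation marks the unprinted clause «e.g., it will be enough to take α = 1/12»
— print fixes α = 1/12 only on p. 199 — and a display that is not the printed (1.91): sides interchanged, middle terms of the
(1.46)-mechanism); no declaration, statement or proof changed (the theorems below were always stated against r12's typed leaf
`B15.PrelimIntegrations.Ineq191`, which carries the printed (1.91)).

WHAT THIS FILE PROVES (kernel-checked, zero `sorry`; no `def`, no new `Prop`, no new named fact; axioms standard).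
* `ineq191_lattice_of_ineq190_gamma` (one-sup reading, the plaquette covariant derivative `plaqCovDeriv` as ONE quantity) and
  `ineq191_lattice_twoSup_of_ineq190_gamma` (two-sup reading, `α ↦ 2α`, GAPS G-B15-05) — r12's leaf `Ineq191` for p29's
  lattice plaquette deviations `|U_{h,□}(V″,∂p) − 1|`, `|U″_{k,Z}(∂p) − 1|`, with the bounds `< αε_h` on `ℍ_{h,□}` at the four
  bonds of `∂p` and on its covariant derivative(s) NOT assumed but DERIVED: (190) for two block sizes `bout₀` (function),
  `bout₁` (derivative) at the base point `y`, (2.61), the argument field of B-size `≤ 11d²ε_h` at distance `≥ D` with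
  `δ2LM₂R_h ≤ τD`, `Cκ_Bc ≤ B₃`, mean-value domination (⇒ (1.90)₁ `BoundH190`), then members 2–3 from γ ((2.5) for `R_h`,
  `0 < g_h ≤ γ`, `log γ⁻² ≥ 1`, `δ2LM₂ > 1`, `R_h > 0`, clause `11d²B₃γ² < α`); the DICTIONARY `hdom₁…₄`, `hdomD…`.
* §2 (v1.1) `ineq196_lattice_of_ineq190_gamma` — **(1.96)** on the lattice with BOTH `ℍ`-chains ((1.92)/(1.93)) derived from
  (190) and γ at print's `α = 1/12` (r12's `B15Ineq191Lattice.ineq196_lattice` by name; the `χ_{h,1/2}` restriction as printed).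
* §3 (v1.2) `ineq198_lattice_of_ineq190_gamma` — **(1.98)** on the lattice with both `ℍ`-chains of pp. 199–200 derived from
  (190) and γ (`0 ≤ α ≤ 1/8`), the (1.80) input as printed (r12's `B15Ineq191Lattice.ineq198_lattice` by name).
HONEST SCOPE.  (190) and the dictionary are hypotheses; lattice model as in `B15Ineq191Lattice` (unitary-valued configurations
in a C⋆-algebra, self-adjoint `ℍ`).  NOT summit progress.
-/

open NormedSpace Finset Complex

namespace Literature.MathematicalPhysics.QuantumFieldTheory.Balaban1983to89.B15Ineq191From190

open Literature.MathematicalPhysics.QuantumFieldTheory.Balaban1983to89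
open B11SectG B7Prop1Explicit B15.PrelimIntegrations B15StandardRep B15HDecayLeaves B15GammaSmallness B15Ineq191Lattice

/-- **(1.90) ⇒ (1.91) ON THE LATTICE, FROM [15] (190) AND γ — one-sup reading.**
[cite: Balaban1989LargeFieldI, (1.90)–(1.91) p.198; Balaban1985Variational, (190) p.308] -/
theorem ineq191_lattice_of_ineq190_gamma
    -- [15]'s block-majorant data, two sizes
    {gB : B6.Geometry} {FB FA : Type} [AddCommGroup FB] [Module ℝ FB] [AddCommGroup FA] [Module ℝ FA]
    {T : Type*} {bB : BlockNorm gB FB} {bout₀ bout₁ : BlockNorm gB FA} {dH : T → FB →ₗ[ℝ] FA}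
    {C δ₀ σ τ c D B₃ δ L M₂ εh γ gh α : ℝ} {Lnat r R : ℕ}
    (h190₀ : ∀ t, Ineq190 bB bout₀ (dH t) C δ₀) (h190₁ : ∀ t, Ineq190 bB bout₁ (dH t) C δ₀) (hC : 0 ≤ C)
    (hd : ∀ a b : gB.Site, 0 ≤ gB.dist a b) (hrow : RowSum gB σ c) (hτ : 0 ≤ τ) (hστ : σ + τ ≤ δ₀ / 8)
    (B : FB) (y : gB.Site)
    -- the lattice data
    {d : ℕ} {𝔸 : Type*} [CStarAlgebra 𝔸] [Nontrivial 𝔸]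
    {ξ : ℝ} (hξ : 0 < ξ) {U₀ : B7Prop1Explicit.Site d → Fin d → 𝔸ˣ} (h₀ : ∀ z κ, U₀ z κ ∈ U1 𝔸)
    {H : B7Prop1Explicit.Site d → Fin d → 𝔸} (hH : ∀ z κ, IsSelfAdjoint (H z κ))
    {g : B7Prop1Explicit.Site d → 𝔸ˣ} (hg : ∀ z, g z ∈ U1 𝔸) (μ ν : Fin d) (x : B7Prop1Explicit.Site d) {Linv : ℝ}
    (hm : ∀ y', bB.loc y' B ≤ 11 * (d : ℝ) ^ 2 * εh) (hD : ∀ y', bB.loc y' B ≠ 0 → D ≤ gB.dist y y')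
    {HB : FA} (hmv₀ : ∀ s : ℝ, (∀ t, bout₀.loc y (dH t B) ≤ s) → bout₀.loc y HB ≤ s)
    (hmv₁ : ∀ s : ℝ, (∀ t, bout₁.loc y (dH t B) ≤ s) → bout₁.loc y HB ≤ s)
    (hgeom : δ * 2 * L * M₂ * R ≤ τ * D) (hCB : C * bB.κ * c ≤ B₃) (hB₃ : 0 < B₃)
    -- γ data
    (hr : 1 ≤ r) (hR : B14.IsRj Lnat r gh R) (hgh : 0 < gh) (hgγ : gh ≤ γ) (hγe : 1 ≤ Real.log (γ ^ 2)⁻¹)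
    (hc1 : 1 < δ * 2 * L * M₂) (hRh : 0 < (R : ℝ)) (hdpos : 0 < d) (hε : 0 < εh)
    (hγ : 11 * (d : ℝ) ^ 2 * B₃ * γ ^ 2 < α)
    -- the dictionary
    (hdom₁ : ‖H x μ‖ ≤ bout₀.loc y HB) (hdom₂ : ‖H (x + e μ) ν‖ ≤ bout₀.loc y HB)
    (hdom₃ : ‖H (x + e ν) μ‖ ≤ bout₀.loc y HB) (hdom₄ : ‖H x ν‖ ≤ bout₀.loc y HB)
    (hdomD : ‖B8Eq146AExpansion.plaqCovDeriv ξ U₀ H μ ν x‖ ≤ bout₁.loc y HB) (hLinv : 0 ≤ Linv) :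
    Ineq191 ‖B8Ineq132.plaqF (gaugeAct g (B8Lemma1NonAbelian.mulCfg (B8Eq146AExpansion.expCfg
        (B8Eq146AExpansion.iEta ξ H)) U₀)) μ ν x - 1‖ ‖B8Ineq132.plaqF U₀ μ ν x - 1‖ α Linv εh (εh * ξ ^ 2) := by
  have hdR : (0 : ℝ) < d := by exact_mod_cast hdpos
  have hb₀ := boundH190_of_ineq190 h190₀ hC hd hrow hτ hστ B y hm hD hmv₀ hgeom hCB hB₃.le hε.le
  have hb₁ := boundH190_of_ineq190 h190₁ hC hd hrow hτ hστ B y hm hD hmv₁ hgeom hCB hB₃.le hε.le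
  have hs₀ := boundH190_lt_alpha_of_gamma hr hb₀ hR hgh hgγ hγe hc1 hRh hB₃ hdR hε hγ
  have hs₁ := boundH190_lt_alpha_of_gamma hr hb₁ hR hgh hgγ hγe hc1 hRh hB₃ hdR hε hγ
  set Y := max (bout₀.loc y HB) (bout₁.loc y HB) with hY
  have hYlt : Y < α * εh := max_lt hs₀ hs₁
  exact ineq191_lattice hξ h₀ hH hg μ ν x (hdom₁.trans (le_max_left _ _)) (hdom₂.trans (le_max_left _ _))
    (hdom₃.trans (le_max_left _ _)) (hdom₄.trans (le_max_left _ _)) (hdomD.trans (le_max_right _ _)) hYlt hε.le hLinv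

/-- **(1.90) ⇒ (1.91) ON THE LATTICE, FROM [15] (190) AND γ — two-sup reading** (the two covariant derivatives separately,
`α ↦ 2α`; GAPS G-B15-05). [cite: Balaban1989LargeFieldI, (1.90)–(1.91) p.198; Balaban1985Variational, (190) p.308] -/
theorem ineq191_lattice_twoSup_of_ineq190_gamma
    {gB : B6.Geometry} {FB FA : Type} [AddCommGroup FB] [Module ℝ FB] [AddCommGroup FA] [Module ℝ FA]
    {T : Type*} {bB : BlockNorm gB FB} {bout₀ bout₁ : BlockNorm gB FA} {dH : T → FB →ₗ[ℝ] FA}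
    {C δ₀ σ τ c D B₃ δ L M₂ εh γ gh α : ℝ} {Lnat r R : ℕ}
    (h190₀ : ∀ t, Ineq190 bB bout₀ (dH t) C δ₀) (h190₁ : ∀ t, Ineq190 bB bout₁ (dH t) C δ₀) (hC : 0 ≤ C)
    (hd : ∀ a b : gB.Site, 0 ≤ gB.dist a b) (hrow : RowSum gB σ c) (hτ : 0 ≤ τ) (hστ : σ + τ ≤ δ₀ / 8)
    (B : FB) (y : gB.Site)
    {d : ℕ} {𝔸 : Type*} [CStarAlgebra 𝔸] [Nontrivial 𝔸]
    {ξ : ℝ} (hξ : 0 < ξ) {U₀ : B7Prop1Explicit.Site d → Fin d → 𝔸ˣ} (h₀ : ∀ z κ, U₀ z κ ∈ U1 𝔸)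
    {H : B7Prop1Explicit.Site d → Fin d → 𝔸} (hH : ∀ z κ, IsSelfAdjoint (H z κ))
    {g : B7Prop1Explicit.Site d → 𝔸ˣ} (hg : ∀ z, g z ∈ U1 𝔸) (μ ν : Fin d) (x : B7Prop1Explicit.Site d) {Linv : ℝ}
    (hm : ∀ y', bB.loc y' B ≤ 11 * (d : ℝ) ^ 2 * εh) (hD : ∀ y', bB.loc y' B ≠ 0 → D ≤ gB.dist y y')
    {HB : FA} (hmv₀ : ∀ s : ℝ, (∀ t, bout₀.loc y (dH t B) ≤ s) → bout₀.loc y HB ≤ s)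
    (hmv₁ : ∀ s : ℝ, (∀ t, bout₁.loc y (dH t B) ≤ s) → bout₁.loc y HB ≤ s)
    (hgeom : δ * 2 * L * M₂ * R ≤ τ * D) (hCB : C * bB.κ * c ≤ B₃) (hB₃ : 0 < B₃)
    (hr : 1 ≤ r) (hR : B14.IsRj Lnat r gh R) (hgh : 0 < gh) (hgγ : gh ≤ γ) (hγe : 1 ≤ Real.log (γ ^ 2)⁻¹)
    (hc1 : 1 < δ * 2 * L * M₂) (hRh : 0 < (R : ℝ)) (hdpos : 0 < d) (hε : 0 < εh)
    (hγ : 11 * (d : ℝ) ^ 2 * B₃ * γ ^ 2 < α)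
    (hdom₁ : ‖H x μ‖ ≤ bout₀.loc y HB) (hdom₂ : ‖H (x + e μ) ν‖ ≤ bout₀.loc y HB)
    (hdom₃ : ‖H (x + e ν) μ‖ ≤ bout₀.loc y HB) (hdom₄ : ‖H x ν‖ ≤ bout₀.loc y HB)
    (hdomD₁ : ‖B8Ineq132.covDerivFwd ξ U₀ μ (fun z => H z ν) x‖ ≤ bout₁.loc y HB)
    (hdomD₂ : ‖B8Ineq132.covDerivFwd ξ U₀ ν (fun z => H z μ) x‖ ≤ bout₁.loc y HB) (hLinv : 0 ≤ Linv) :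
    Ineq191 ‖B8Ineq132.plaqF (gaugeAct g (B8Lemma1NonAbelian.mulCfg (B8Eq146AExpansion.expCfg
        (B8Eq146AExpansion.iEta ξ H)) U₀)) μ ν x - 1‖ ‖B8Ineq132.plaqF U₀ μ ν x - 1‖ (2 * α) Linv εh (εh * ξ ^ 2) := by
  have hdR : (0 : ℝ) < d := by exact_mod_cast hdpos
  have hb₀ := boundH190_of_ineq190 h190₀ hC hd hrow hτ hστ B y hm hD hmv₀ hgeom hCB hB₃.le hε.le
  have hb₁ := boundH190_of_ineq190 h190₁ hC hd hrow hτ hστ B y hm hD hmv₁ hgeom hCB hB₃.le hε.le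
  have hs₀ := boundH190_lt_alpha_of_gamma hr hb₀ hR hgh hgγ hγe hc1 hRh hB₃ hdR hε hγ
  have hs₁ := boundH190_lt_alpha_of_gamma hr hb₁ hR hgh hgγ hγe hc1 hRh hB₃ hdR hε hγ
  set Y := max (bout₀.loc y HB) (bout₁.loc y HB) with hY
  have hYlt : Y < α * εh := max_lt hs₀ hs₁
  exact ineq191_lattice_twoSup hξ h₀ hH hg μ ν x (hdom₁.trans (le_max_left _ _)) (hdom₂.trans (le_max_left _ _))
    (hdom₃.trans (le_max_left _ _)) (hdom₄.trans (le_max_left _ _)) (hdomD₁.trans (le_max_right _ _))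
    (hdomD₂.trans (le_max_right _ _)) hYlt hε.le hLinv

/-! ## §2 (v1.1). (1.96) on the lattice from (190): both `ℍ`-chains derived -/

/-- **(1.96) ON THE LATTICE, FROM [15] (190) AND γ** — pp. 198–199 [PDF 24–25], verbatim: *"The function ℍ_{h,□} above,
and its derivatives, can be bounded on □^∼ by [(1.94)] < αε_h. … From the representation (1.93) and the above bounds we get
[(1.95)]. The estimates (1.91), (1.95) yield |U″_{k,Z}(∂p) − 1| < ¾ε_h(L^{k−h}η)² < (1 − β(1 − 2^{−(k−h+1)}))ε_h(L^{k−h}η)² (1.96)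
for p ⊂ □^∼, hence on the whole domain (Ω″^∼_{h+1})^c ∩ Ω_h. We have chosen α = 1/12 in (1.91), (1.94), (1.95)."* (v1.3:
quotation restored verbatim — v1.1/v1.2 carried here an unprinted paraphrase «The fields in the exponential transformations
(1.92), (1.93) … as in the case of ℍ_{h,□} … the restriction introduced by χ_{h,1/2} yield …»; QUOTE-AUDIT-B15 finding A5):
r12's `B15Ineq191Lattice.ineq196_lattice` with BOTH `ℍ`-chains (`ℍ₁` of the representation of
`U_{h,□}(V″)` over `U″_{k,Z}`, `ℍ₂` of (1.93)/(1.95) over `U_{h,□}(1,V_h)`) NOT assumed `< αε_h` but DERIVED from (190): for each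
chain the block sizes `bout₀` (function) / `bout₁` (plaquette covariant derivative) at the base point `y`, its argument field
(`Bf1`, `Bf2` below) of B-size `≤ 11d²ε_h` at distance `≥ D` with `δ2LM₂R_h ≤ τD`, mean-value domination, the dictionary; members 2–3
of (1.90) from γ with print's `α = 1/12` (clause `11d²B₃γ² < 1/12`); the `χ_{h,1/2}`-restriction `hhalf`, `L^{−2(j−h)} ≤ 1`,
`0 < ε_h ≤ 1/10`, `β ≤ ¼`, `0 < t ≤ 1` (`t` = print's `2^{−(k−h+1)}`) as in `ineq196_lattice`.
[cite: Balaban1989LargeFieldI, (1.92)–(1.96) pp.198–199; Balaban1985Variational, (190) p.308] -/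
theorem ineq196_lattice_of_ineq190_gamma
    -- [15]'s block-majorant data: one geometry, two argument fields
    {gB : B6.Geometry} {FB FA : Type} [AddCommGroup FB] [Module ℝ FB] [AddCommGroup FA] [Module ℝ FA]
    {T : Type*} {bB : BlockNorm gB FB} {bout₀ bout₁ : BlockNorm gB FA} {dH : T → FB →ₗ[ℝ] FA}
    {C δ₀ σ τ c D B₃ δ L M₂ εh γ gh β t : ℝ} {Lnat r R : ℕ}
    (h190₀ : ∀ t, Ineq190 bB bout₀ (dH t) C δ₀) (h190₁ : ∀ t, Ineq190 bB bout₁ (dH t) C δ₀) (hC : 0 ≤ C)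
    (hd : ∀ a b : gB.Site, 0 ≤ gB.dist a b) (hrow : RowSum gB σ c) (hτ : 0 ≤ τ) (hστ : σ + τ ≤ δ₀ / 8)
    (Bf1 Bf2 : FB) (y : gB.Site)
    -- the lattice data (as in `ineq196_lattice`)
    {d : ℕ} {𝔸 : Type*} [CStarAlgebra 𝔸] [Nontrivial 𝔸] {ξ : ℝ} (hξ : 0 < ξ)
    {Uhb : B7Prop1Explicit.Site d → Fin d → 𝔸ˣ} (hUhb : ∀ z κ, Uhb z κ ∈ U1 𝔸)
    {H₁ : B7Prop1Explicit.Site d → Fin d → 𝔸} (hH₁sa : ∀ z κ, IsSelfAdjoint (H₁ z κ))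
    {g₁ : B7Prop1Explicit.Site d → 𝔸ˣ} (hg₁ : ∀ z, g₁ z ∈ U1 𝔸)
    {U₁ : B7Prop1Explicit.Site d → Fin d → 𝔸ˣ} (hU₁ : ∀ z κ, U₁ z κ ∈ U1 𝔸)
    {H₂ : B7Prop1Explicit.Site d → Fin d → 𝔸} (hH₂sa : ∀ z κ, IsSelfAdjoint (H₂ z κ))
    {g₂ : B7Prop1Explicit.Site d → 𝔸ˣ} (hg₂ : ∀ z, g₂ z ∈ U1 𝔸)
    (hrep : Uhb = gaugeAct g₂ (B8Lemma1NonAbelian.mulCfg (B8Eq146AExpansion.expCfg (B8Eq146AExpansion.iEta ξ H₂)) U₁))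
    (μ ν : Fin d) (x : B7Prop1Explicit.Site d) {Linv : ℝ}
    -- the two argument fields: size ≤ 11d²ε_h, localised at distance ≥ D; mean-value domination for each value
    (hm1 : ∀ y', bB.loc y' Bf1 ≤ 11 * (d : ℝ) ^ 2 * εh) (hD1 : ∀ y', bB.loc y' Bf1 ≠ 0 → D ≤ gB.dist y y')
    (hm2 : ∀ y', bB.loc y' Bf2 ≤ 11 * (d : ℝ) ^ 2 * εh) (hD2 : ∀ y', bB.loc y' Bf2 ≠ 0 → D ≤ gB.dist y y')
    {HBf1 HBf2 : FA}
    (hmv01 : ∀ s : ℝ, (∀ t, bout₀.loc y (dH t Bf1) ≤ s) → bout₀.loc y HBf1 ≤ s)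
    (hmv11 : ∀ s : ℝ, (∀ t, bout₁.loc y (dH t Bf1) ≤ s) → bout₁.loc y HBf1 ≤ s)
    (hmv02 : ∀ s : ℝ, (∀ t, bout₀.loc y (dH t Bf2) ≤ s) → bout₀.loc y HBf2 ≤ s)
    (hmv12 : ∀ s : ℝ, (∀ t, bout₁.loc y (dH t Bf2) ≤ s) → bout₁.loc y HBf2 ≤ s)
    (hgeom : δ * 2 * L * M₂ * R ≤ τ * D) (hCB : C * bB.κ * c ≤ B₃) (hB₃ : 0 < B₃)
    -- γ data with print's α = 1/12
    (hr : 1 ≤ r) (hR : B14.IsRj Lnat r gh R) (hgh : 0 < gh) (hgγ : gh ≤ γ) (hγe : 1 ≤ Real.log (γ ^ 2)⁻¹)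
    (hc1 : 1 < δ * 2 * L * M₂) (hRh : 0 < (R : ℝ)) (hdpos : 0 < d) (hε0 : 0 < εh)
    (hγ : 11 * (d : ℝ) ^ 2 * B₃ * γ ^ 2 < 1 / 12)
    -- the dictionary, both chains
    (hdomA₁ : ‖H₁ x μ‖ ≤ bout₀.loc y HBf1) (hdomA₂ : ‖H₁ (x + e μ) ν‖ ≤ bout₀.loc y HBf1)
    (hdomA₃ : ‖H₁ (x + e ν) μ‖ ≤ bout₀.loc y HBf1) (hdomA₄ : ‖H₁ x ν‖ ≤ bout₀.loc y HBf1)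
    (hdomAD : ‖B8Eq146AExpansion.plaqCovDeriv ξ Uhb H₁ μ ν x‖ ≤ bout₁.loc y HBf1)
    (hdomB₁ : ‖H₂ x μ‖ ≤ bout₀.loc y HBf2) (hdomB₂ : ‖H₂ (x + e μ) ν‖ ≤ bout₀.loc y HBf2)
    (hdomB₃ : ‖H₂ (x + e ν) μ‖ ≤ bout₀.loc y HBf2) (hdomB₄ : ‖H₂ x ν‖ ≤ bout₀.loc y HBf2)
    (hdomBD : ‖B8Eq146AExpansion.plaqCovDeriv ξ U₁ H₂ μ ν x‖ ≤ bout₁.loc y HBf2)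
    -- the located inputs of `ineq196_lattice`
    (hhalf : ‖B8Ineq132.plaqF U₁ μ ν x - 1‖ < 1 / 2 * (εh * ξ ^ 2)) (hL0 : 0 ≤ Linv) (hL1 : Linv ≤ 1)
    (hε1 : εh ≤ 1 / 10) (hβ : β ≤ 1 / 4) (ht0 : 0 < t) (ht1 : t ≤ 1) :
    B15.BasicStep.Ineq196 ‖B8Ineq132.plaqF (gaugeAct g₁ (B8Lemma1NonAbelian.mulCfg (B8Eq146AExpansion.expCfg
        (B8Eq146AExpansion.iEta ξ H₁)) Uhb)) μ ν x - 1‖ β t (εh * ξ ^ 2) := by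
  have hdR : (0 : ℝ) < d := by exact_mod_cast hdpos
  -- chain 1
  have hb01 := boundH190_of_ineq190 h190₀ hC hd hrow hτ hστ Bf1 y hm1 hD1 hmv01 hgeom hCB hB₃.le hε0.le
  have hb11 := boundH190_of_ineq190 h190₁ hC hd hrow hτ hστ Bf1 y hm1 hD1 hmv11 hgeom hCB hB₃.le hε0.le
  have hs01 := boundH190_lt_alpha_of_gamma hr hb01 hR hgh hgγ hγe hc1 hRh hB₃ hdR hε0 hγ
  have hs11 := boundH190_lt_alpha_of_gamma hr hb11 hR hgh hgγ hγe hc1 hRh hB₃ hdR hε0 hγ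
  -- chain 2
  have hb02 := boundH190_of_ineq190 h190₀ hC hd hrow hτ hστ Bf2 y hm2 hD2 hmv02 hgeom hCB hB₃.le hε0.le
  have hb12 := boundH190_of_ineq190 h190₁ hC hd hrow hτ hστ Bf2 y hm2 hD2 hmv12 hgeom hCB hB₃.le hε0.le
  have hs02 := boundH190_lt_alpha_of_gamma hr hb02 hR hgh hgγ hγe hc1 hRh hB₃ hdR hε0 hγ
  have hs12 := boundH190_lt_alpha_of_gamma hr hb12 hR hgh hgγ hγe hc1 hRh hB₃ hdR hε0 hγ
  set Y₁ := max (bout₀.loc y HBf1) (bout₁.loc y HBf1) with hY₁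
  set Y₂ := max (bout₀.loc y HBf2) (bout₁.loc y HBf2) with hY₂
  have hY₁lt : Y₁ < 1 / 12 * εh := max_lt hs01 hs11
  have hY₂lt : Y₂ < 1 / 12 * εh := max_lt hs02 hs12
  exact ineq196_lattice hξ hUhb hH₁sa hg₁ hU₁ hH₂sa hg₂ hrep μ ν x
    (hdomA₁.trans (le_max_left _ _)) (hdomA₂.trans (le_max_left _ _)) (hdomA₃.trans (le_max_left _ _))
    (hdomA₄.trans (le_max_left _ _)) (hdomAD.trans (le_max_right _ _)) hY₁lt
    (hdomB₁.trans (le_max_left _ _)) (hdomB₂.trans (le_max_left _ _)) (hdomB₃.trans (le_max_left _ _))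
    (hdomB₄.trans (le_max_left _ _)) (hdomBD.trans (le_max_right _ _)) hY₂lt
    hhalf rfl hL0 hL1 hε0 hε1 hβ ht0 ht1

/-! ## §3 (v1.2). (1.98) on the lattice from (190): both `ℍ`-chains of p. 199–200 derived -/

/-- **(1.98) ON THE LATTICE, FROM [15] (190) AND γ** — pp. 199–200 [PDF 25–26], verbatim: *"The ℍ-function in the expansion
can be bounded on the domain Z″_{j+1}∖Z″_j for h < j < k, Z″_{h+1}∖(Ω″^∼_{h+1})^c for j = h, and Ω^c_k∖Z″_k for j = k, by …
< αε_j. … The corresponding ℍ-function can be bounded on the same domains as above by B₃δ′_k ≦ … < αε_j. … Combining the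
above estimates, and using the inequality ε_kη² ≦ (1 + β₀)(k − j)^{1/2}L^{−2(k−j)}ε_j(L^{k−j}η)² ≦ L^{−(k−j)}ε_j(L^{k−j}η)² for
j < k, we obtain |U″_{k,Z}(∂p) − 1| < (2ε_kη² + O(1)B₃B₅M⁵exp(−δdist(p,Λ))ε_kη²)·(1 + L^{−j}αε_j)² + (2 + L^{−j}αε_j)(α +
8α²ε_j)ε_j(L^{k−j}η)² ≦ … (1.98)"* (v1.3: quotation restored verbatim — v1.2 carried here the unprinted words «Let us consider
p ∈ T_ξ, ξ = L^{−j}» and «+ 4αε_jξ²» in place of the printed second term; QUOTE-AUDIT-B15 finding A4):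
r12's `B15Ineq191Lattice.ineq198_lattice` with the
two `ℍ`-chains at scale `j` (`ℍ₁`: `U″_{k,Z}` over the configuration `C` of (1.97); `ℍ₂`: `C` over `C₀ = U₀^{ū₀}`) NOT assumed
`< αε_j` but DERIVED from (190) (block sizes `bout₀`/`bout₁` at `y`, argument fields `Bf1`/`Bf2` of B-size `≤ 11d²ε_j` at
distance `≥ D`, `δ2LM₂R_j ≤ τD`, mean-value domination, the dictionary) and γ ((2.5) for `R_j`, `0 < g_j ≤ γ`, `log γ⁻² ≥ 1`,
`δ2LM₂ > 1`, clause `11d²B₃γ² < α`); the (1.80) input `h180`, `0 ≤ α ≤ 1/8`, the scale inequality and signs as located in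
`ineq198_lattice`. [cite: Balaban1989LargeFieldI, (1.97)–(1.98) pp.199–200; Balaban1985Variational, (190) p.308] -/
theorem ineq198_lattice_of_ineq190_gamma
    {gB : B6.Geometry} {FB FA : Type} [AddCommGroup FB] [Module ℝ FB] [AddCommGroup FA] [Module ℝ FA]
    {T : Type*} {bB : BlockNorm gB FB} {bout₀ bout₁ : BlockNorm gB FA} {dH : T → FB →ₗ[ℝ] FA}
    {C δ₀ σ τ c D B₃ δL L M₂ εj γ gj α : ℝ} {Lnat r R : ℕ}
    (h190₀ : ∀ t, Ineq190 bB bout₀ (dH t) C δ₀) (h190₁ : ∀ t, Ineq190 bB bout₁ (dH t) C δ₀) (hC : 0 ≤ C)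
    (hd : ∀ a b : gB.Site, 0 ≤ gB.dist a b) (hrow : RowSum gB σ c) (hτ : 0 ≤ τ) (hστ : σ + τ ≤ δ₀ / 8)
    (Bf1 Bf2 : FB) (y : gB.Site)
    -- the lattice data (as in `ineq198_lattice`)
    {d : ℕ} {𝔸 : Type*} [CStarAlgebra 𝔸] [Nontrivial 𝔸] {ξ : ℝ} (hξ : 0 < ξ)
    {Cc : B7Prop1Explicit.Site d → Fin d → 𝔸ˣ} (hCc : ∀ z κ, Cc z κ ∈ U1 𝔸)
    {H₁ : B7Prop1Explicit.Site d → Fin d → 𝔸} (hH₁sa : ∀ z κ, IsSelfAdjoint (H₁ z κ))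
    {g₁ : B7Prop1Explicit.Site d → 𝔸ˣ} (hg₁ : ∀ z, g₁ z ∈ U1 𝔸)
    {C₀ : B7Prop1Explicit.Site d → Fin d → 𝔸ˣ} (hC₀ : ∀ z κ, C₀ z κ ∈ U1 𝔸)
    {H₂ : B7Prop1Explicit.Site d → Fin d → 𝔸} (hH₂sa : ∀ z κ, IsSelfAdjoint (H₂ z κ))
    {g₂ : B7Prop1Explicit.Site d → 𝔸ˣ} (hg₂ : ∀ z, g₂ z ∈ U1 𝔸)
    (hrep : Cc = gaugeAct g₂ (B8Lemma1NonAbelian.mulCfg (B8Eq146AExpansion.expCfg (B8Eq146AExpansion.iEta ξ H₂)) C₀))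
    (μ ν : Fin d) (x : B7Prop1Explicit.Site d) {Linv εk η B₅ M δ dist Cst Lkj : ℝ}
    (hm1 : ∀ y', bB.loc y' Bf1 ≤ 11 * (d : ℝ) ^ 2 * εj) (hD1 : ∀ y', bB.loc y' Bf1 ≠ 0 → D ≤ gB.dist y y')
    (hm2 : ∀ y', bB.loc y' Bf2 ≤ 11 * (d : ℝ) ^ 2 * εj) (hD2 : ∀ y', bB.loc y' Bf2 ≠ 0 → D ≤ gB.dist y y')
    {HBf1 HBf2 : FA}
    (hmv01 : ∀ s : ℝ, (∀ t, bout₀.loc y (dH t Bf1) ≤ s) → bout₀.loc y HBf1 ≤ s)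
    (hmv11 : ∀ s : ℝ, (∀ t, bout₁.loc y (dH t Bf1) ≤ s) → bout₁.loc y HBf1 ≤ s)
    (hmv02 : ∀ s : ℝ, (∀ t, bout₀.loc y (dH t Bf2) ≤ s) → bout₀.loc y HBf2 ≤ s)
    (hmv12 : ∀ s : ℝ, (∀ t, bout₁.loc y (dH t Bf2) ≤ s) → bout₁.loc y HBf2 ≤ s)
    (hgeom : δL * 2 * L * M₂ * R ≤ τ * D) (hCB : C * bB.κ * c ≤ B₃) (hB₃ : 0 < B₃)
    -- γ data
    (hr : 1 ≤ r) (hR : B14.IsRj Lnat r gj R) (hgj : 0 < gj) (hgγ : gj ≤ γ) (hγe : 1 ≤ Real.log (γ ^ 2)⁻¹)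
    (hc1 : 1 < δL * 2 * L * M₂) (hRj : 0 < (R : ℝ)) (hdpos : 0 < d) (hε0 : 0 < εj)
    (hγ : 11 * (d : ℝ) ^ 2 * B₃ * γ ^ 2 < α)
    -- the dictionary, both chains
    (hdomA₁ : ‖H₁ x μ‖ ≤ bout₀.loc y HBf1) (hdomA₂ : ‖H₁ (x + e μ) ν‖ ≤ bout₀.loc y HBf1)
    (hdomA₃ : ‖H₁ (x + e ν) μ‖ ≤ bout₀.loc y HBf1) (hdomA₄ : ‖H₁ x ν‖ ≤ bout₀.loc y HBf1)
    (hdomAD : ‖B8Eq146AExpansion.plaqCovDeriv ξ Cc H₁ μ ν x‖ ≤ bout₁.loc y HBf1)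
    (hdomB₁ : ‖H₂ x μ‖ ≤ bout₀.loc y HBf2) (hdomB₂ : ‖H₂ (x + e μ) ν‖ ≤ bout₀.loc y HBf2)
    (hdomB₃ : ‖H₂ (x + e ν) μ‖ ≤ bout₀.loc y HBf2) (hdomB₄ : ‖H₂ x ν‖ ≤ bout₀.loc y HBf2)
    (hdomBD : ‖B8Eq146AExpansion.plaqCovDeriv ξ C₀ H₂ μ ν x‖ ≤ bout₁.loc y HBf2)
    -- the located inputs of `ineq198_lattice`
    (h180 : B15.Ineq180 ‖B8Ineq132.plaqF C₀ μ ν x - 1‖ εk η B₃ B₅ M δ dist Cst)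
    (hα0 : 0 ≤ α) (hα : α ≤ 1 / 8) (hL0 : 0 ≤ Linv) (hL1 : Linv ≤ 1) (hε1 : εj ≤ 1 / 10)
    (hX : 0 ≤ Cst * B₃ * B₅ * M ^ 5 * Real.exp (-δ * dist)) (he : 0 ≤ εk * η ^ 2)
    (hscale : εk * η ^ 2 ≤ Lkj * (εj * ξ ^ 2)) (hLkj1 : Lkj ≤ 1) :
    ‖B8Ineq132.plaqF (gaugeAct g₁ (B8Lemma1NonAbelian.mulCfg (B8Eq146AExpansion.expCfg
        (B8Eq146AExpansion.iEta ξ H₁)) Cc)) μ ν x - 1‖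
      < (2 * Lkj + 4 * α + Cst * (1 + Linv * α * εj) ^ 2 * B₃ * B₅ * M ^ 5 * Real.exp (-δ * dist) * Lkj)
        * (εj * ξ ^ 2) := by
  have hdR : (0 : ℝ) < d := by exact_mod_cast hdpos
  have hb01 := boundH190_of_ineq190 h190₀ hC hd hrow hτ hστ Bf1 y hm1 hD1 hmv01 hgeom hCB hB₃.le hε0.le
  have hb11 := boundH190_of_ineq190 h190₁ hC hd hrow hτ hστ Bf1 y hm1 hD1 hmv11 hgeom hCB hB₃.le hε0.le
  have hb02 := boundH190_of_ineq190 h190₀ hC hd hrow hτ hστ Bf2 y hm2 hD2 hmv02 hgeom hCB hB₃.le hε0.le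
  have hb12 := boundH190_of_ineq190 h190₁ hC hd hrow hτ hστ Bf2 y hm2 hD2 hmv12 hgeom hCB hB₃.le hε0.le
  have hs01 := boundH190_lt_alpha_of_gamma hr hb01 hR hgj hgγ hγe hc1 hRj hB₃ hdR hε0 hγ
  have hs11 := boundH190_lt_alpha_of_gamma hr hb11 hR hgj hgγ hγe hc1 hRj hB₃ hdR hε0 hγ
  have hs02 := boundH190_lt_alpha_of_gamma hr hb02 hR hgj hgγ hγe hc1 hRj hB₃ hdR hε0 hγ
  have hs12 := boundH190_lt_alpha_of_gamma hr hb12 hR hgj hgγ hγe hc1 hRj hB₃ hdR hε0 hγ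
  set Y₁ := max (bout₀.loc y HBf1) (bout₁.loc y HBf1) with hY₁
  set Y₂ := max (bout₀.loc y HBf2) (bout₁.loc y HBf2) with hY₂
  have hY₁lt : Y₁ < α * εj := max_lt hs01 hs11
  have hY₂lt : Y₂ < α * εj := max_lt hs02 hs12
  exact ineq198_lattice hξ hCc hH₁sa hg₁ hC₀ hH₂sa hg₂ hrep μ ν x
    (hdomA₁.trans (le_max_left _ _)) (hdomA₂.trans (le_max_left _ _)) (hdomA₃.trans (le_max_left _ _))
    (hdomA₄.trans (le_max_left _ _)) (hdomAD.trans (le_max_right _ _)) hY₁lt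
    (hdomB₁.trans (le_max_left _ _)) (hdomB₂.trans (le_max_left _ _)) (hdomB₃.trans (le_max_left _ _))
    (hdomB₄.trans (le_max_left _ _)) (hdomBD.trans (le_max_right _ _)) hY₂lt
    h180 hα0 hα hL0 hL1 hε0.le hε1 hX he hscale hLkj1

end Literature.MathematicalPhysics.QuantumFieldTheory.Balaban1983to89.B15Ineq191From190
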